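import Summits.BirchSwinnertonDyer.BirchSwinnertonDyer.Theorems.KolyvaginDepthDoorKolyvaginDepthSupplyLeafSign
import Summits.BirchSwinnertonDyer.BirchSwinnertonDyer.Theorems.KolyvaginDepthDoorKolyvaginDepthSupplyLeafLocalPow
import Summits.BirchSwinnertonDyer.BirchSwinnertonDyer.Theorems.KolyvaginDepthDoorKolyvaginDepthSupplyLeafEigenLinePow
import Summits.BirchSwinnertonDyer.BirchSwinnertonDyer.Theorems.KolyvaginDepthDoorKolyvaginDepthSupplyLeafReciprocityPow
import Summits.BirchSwinnertonDyer.BirchSwinnertonDyer.Theorems.KolyvaginDepthDoorDepthTableRowKitNoTwistTwistSelmerOfDatum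
import Summits.BirchSwinnertonDyer.BirchSwinnertonDyer.Theorems.KolyvaginDepthDoorDepthTableRowKitNoTwistDepthTwoOfDatum
import Summits.BirchSwinnertonDyer.BirchSwinnertonDyer.Theorems.KolyvaginDepthDoorKolyvaginDepthSupplyDatumDoor
import Summits.BirchSwinnertonDyer.Rank1Residual.JET.McCallumProp44ByName
import HarnessLib

/-!
# Route `KolyvaginDepthDoor`, crux `KolyvaginDepthSupply` (stmt-BirchSwinnertonDyer-21765) —
# THE FIVE McCALLUM LEAVES FROM TWO STANDARD PUBLISHED INPUTS: every g5–g7 door / kit / row that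
# displays `(h54 h43 h44 h53 h22)` is now conditional on (γ) [Gross 1991 Prop. 3.7 (2)] + F1
# [GZ86 III (3.1)] only

Helper file (`--supports stmt-BirchSwinnertonDyer-21765 --as helper`); it closes nothing and BSD is
not proved by it.

State of the five named leaves of `McCallum1991/KolyvaginClassesLocalLeaves` +
`…LocalOrderComparison` after this seat (g8):
* `h54` `sign_conjAct_kolyvaginClass` — THEOREM (`sign_conjAct_kolyvaginClass_holds`, `…LeafSign`);
* `h43` `lemma43_kolyvaginClass_mem_selmerLocalKer` — from F1 = `Gross1991_heegnerPoint_sub_ratTorsion_mem_E0`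
  (`lemma43_of_gross1991E0`, `…LeafLocalPow`; and PROVED outright on the Kodaira–Néron cell);
* `h44` `prop44_localOrder_kolyvaginClass_mul_eq` — from (γ) = `GrossLMS1991.prop37_2_frobeniusCongruence`
  (`JET.prop44_of_frobeniusCongruence`, cell `bsd-jet`);
* `h53` `lemma53_selmer_eigen_dependent_at` — THEOREM (`lemma53_selmer_eigen_dependent_at_holds`,
  `…LeafEigenLinePow`);
* `h22` `prop22_reciprocity_eigen_finset` — THEOREM (`prop22_reciprocity_eigen_finset_holds`,
  `…LeafReciprocityPow`).

* `mcCallumLeaves_of_print` — the five-fold conjunction from `(h372 : (γ)) (hE0 : F1)`: feed it to ANY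
  of the route's `…_of_datum` / `…_ofDatum` theorems (doors of g5–g7, the 18 rank-2 rows, the 9
  rank-3 depth-2 rows, the 18 twist-Selmer rows, the JLS printed rows) to read them modulo (γ) + F1.
* `depthRow_twistSelmer_print_of_datum_of_intModel_certificate` — g7's twist-Selmer kit fed:
  `#Sel_p(E^{(D)}/ℚ) ≤ p` for a rank-2 row, modulo (γ) + F1 + bit.
* `depthRowTwo_print_of_datum_of_intModel_certificate` — g7's rank-3 depth-2 kit fed: `t_p = 0`,
  `rank = 3`, `#Sel_p(E/ℚ) = p³`, `#Sel_p(E^{(D)}/ℚ) ≤ p²`, modulo (γ) + F1 + the depth-2 bit.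

* PLANNER-FACING: `shaCorankZeroAtOnePrime_of_kolyvaginDepthSupplyDatum_print`,
  `bsd_of_kolyvaginDepthSupplyDatum_print` — g7's datum-form assembly with the five leaves fed:
  `KolyvaginDepthSupplyDatum` + (γ) + F1 + `ShaCorankZeroAtOnePrimeOfCM` ⟹ X1 (= KatoTransfer's
  `ShaCorankZeroAtOnePrime` body); + X2 + X3 + Kato ⟹ `BirchSwinnertonDyer`. Neither the XL support
  item `KolyvaginStructure` nor any McCallum leaf remains among the hypotheses.

CONDITIONAL on the two Literature facts (γ), F1 (cite-only, XL); per-curve; BSD is not proved by it.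

References: [GrossLMS1991] Prop. 3.7 (2), Props. 5.4, 6.2, 8.1, 8.2; [McCallumLMS1991] Prop. 2.2,
Lemma 4.3, Prop. 4.4, Lemma 5.3; [GrossZagier1986] III (3.1); [Kolyvagin1991MathAnn] Thm. 2.3.
-/

set_option linter.dupNamespace false

noncomputable section

open scoped Classical NumberField

namespace Summit.BirchSwinnertonDyer.BirchSwinnertonDyer.Theorems.KolyvaginDepthDoor

open Literature.NumberTheory.EllipticCurves Literature.NumberTheory.EllipticCurves.ModularForms
  Literature.NumberTheory.EllipticCurves.McCallum1991 WeierstrassCurve NumberField IsDedekindDomain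
open Summit.BirchSwinnertonDyer.BirchSwinnertonDyer.Theses.KolyvaginDepthDoor

/-- **The five McCallum / Gross leaves of the route from (γ) + F1**: the sign law, Lemma 5.3 and
Prop. 2.2 are tree theorems; Lemma 4.3 is F1; Prop. 4.4 is (γ). Feed the components to any
`…_of_datum` door / kit / row of the route. [cite: GrossLMS1991, Prop. 3.7 (2), Props. 5.4, 6.2]
[cite: McCallumLMS1991, §§2–5] [cite: GrossZagier1986, III (3.1)] -/
theorem mcCallumLeaves_of_print (h372 : GrossLMS1991.prop37_2_frobeniusCongruence)
    (hE0 : Gross1991_heegnerPoint_sub_ratTorsion_mem_E0) :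
    sign_conjAct_kolyvaginClass ∧ lemma43_kolyvaginClass_mem_selmerLocalKer ∧
      prop44_localOrder_kolyvaginClass_mul_eq ∧ lemma53_selmer_eigen_dependent_at ∧
      prop22_reciprocity_eigen_finset :=
  ⟨sign_conjAct_kolyvaginClass_holds, lemma43_of_gross1991E0 hE0,
    Summit.BirchSwinnertonDyer.Rank1Residual.JET.prop44_of_frobeniusCongruence h372,
    lemma53_selmer_eigen_dependent_at_holds, prop22_reciprocity_eigen_finset_holds⟩

section Kits

variable {W : WeierstrassCurve ℚ} [W.IsElliptic] [W.IsGloballyMinimal] {E₀ : WeierstrassCurve ℤ}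
  (hI : integralModelInt W = E₀)
include hI

/-- **The rank-2 TWIST-SELMER row kit on (γ) + F1**: g7's
`depthRow_noTwist_twistSelmer_of_datum_of_intModel_certificate` with its five leaves fed by
`mcCallumLeaves_of_print`: from the bit at ANY datum of conductor `ℓ`, `#Sel^(p)(E^{(D)}/ℚ) ≤ p`
(`dim ≤ 1`) and `p^{rank E^{(D)}} · #E^{(D)}(ℚ)[p] · #Ш(E^{(D)}/ℚ)[p] ≤ p`. CONDITIONAL on (γ) + F1;
per-curve; BSD is not proved by it. [cite: Kolyvagin1991MathAnn, Thm. 2.3] [cite: GrossLMS1991, §5 (5.1)] -/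
theorem depthRow_twistSelmer_print_of_datum_of_intModel_certificate
    (h372 : GrossLMS1991.prop37_2_frobeniusCongruence)
    (hE0 : Gross1991_heegnerPoint_sub_ratTorsion_mem_E0)
    (hcm : ¬ W.HasCM) (hr : 2 ≤ W.mordellWeilRank)
    (p : ℕ) [hp : Fact p.Prime] (hp2 : p ≠ 2)
    (htower : ∀ n : ℕ, W.HasSurjectiveModNGaloisRep (p ^ n : ℕ))
    (K : Type) [Field K] [NumberField K] (hK : IsImaginaryQuadratic K) {D : ℤ}
    (hD : NumberField.discr K = D) (h3 : D ≠ -3) (h4 : D ≠ -4)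
    (hH : ∀ q : ℕ, q.Prime → (q : ℤ) ∣ E₀.Δ → (q = 2 → D % 8 = 1) ∧ (q ≠ 2 → jacobiSym D q = 1))
    (ℓ : ℕ) (hℓ : ℓ.Prime) (hℓ2 : ℓ ≠ 2) (hℓΔ : ¬ (ℓ : ℤ) ∣ E₀.Δ) (hℓD : ¬ (ℓ : ℤ) ∣ D)
    (hℓp : ℓ ≠ p) (hjac : jacobiSym D ℓ = -1) (hℓ1 : p ∣ ℓ + 1) {n : ℕ}
    (hcard : Nat.card ((E₀.map (Int.castRingHom (ZMod ℓ))).toAffine.Point) = n)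
    (haℓ : (p : ℤ) ∣ (ℓ : ℤ) + 1 - n)
    [NeZero (W.conductorNorm ℤ)] (Dt : ModularParametrizationData W (W.conductorNorm ℤ)) (β : ℤ)
    (ι : K →+* ℂ) (d : KolyvaginHeegnerData Dt β ι ℓ) (hne : d.kolyvaginClass hp.out 1 ≠ 0) :
    Nat.card ↥(selmerGroup (W.quadraticTwist (D : ℚ)) (p : ℤ)) ≤ p ∧
      p ^ (W.quadraticTwist (D : ℚ)).mordellWeilRank *
          Nat.card ↥(AddSubgroup.torsionBy (W.quadraticTwist (D : ℚ)).toAffine.Point (p : ℤ)) *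
          Nat.card ↥((W.quadraticTwist (D : ℚ)).sha ⊓
            AddSubgroup.torsionBy (W.quadraticTwist (D : ℚ)).galH1 (p : ℤ)) ≤ p := by
  obtain ⟨h54, h43, h44, h53, h22⟩ := mcCallumLeaves_of_print h372 hE0
  exact depthRow_noTwist_twistSelmer_of_datum_of_intModel_certificate hI h54 h43 h44 h53 h22 hcm hr p
    hp2 htower K hK hD h3 h4 hH ℓ hℓ hℓ2 hℓΔ hℓD hℓp hjac hℓ1 hcard haℓ Dt β ι d hne

/-- **The rank-3 DEPTH-TWO row kit on (γ) + F1**: g7's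
`depthRowTwo_noTwist_of_datum_of_intModel_certificate` with its five leaves fed by
`mcCallumLeaves_of_print`: from the depth-2 bit at ANY datum of conductor `ℓ₁ℓ₂` and `3 ≤ rank`,
`t_p = 0`, `rank = 3`, `rank E^{(D)} ≤ 2`, `E(ℚ)[p] = 0`, `Ш(E/ℚ)[p] = 0`, `#Sel_p(E/ℚ) = p³`,
`#Sel_p(E^{(D)}/ℚ) ≤ p²`. CONDITIONAL on (γ) + F1; per-curve; BSD is not proved by it.
[cite: Kolyvagin1991MathAnn, Thm. 2.3] [cite: GrossLMS1991, §5 (5.1)] -/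
theorem depthRowTwo_print_of_datum_of_intModel_certificate
    (h372 : GrossLMS1991.prop37_2_frobeniusCongruence)
    (hE0 : Gross1991_heegnerPoint_sub_ratTorsion_mem_E0)
    (hcm : ¬ W.HasCM) (hr : 3 ≤ W.mordellWeilRank)
    (p : ℕ) [hp : Fact p.Prime] (hp2 : p ≠ 2)
    (htower : ∀ n : ℕ, W.HasSurjectiveModNGaloisRep (p ^ n : ℕ))
    (K : Type) [Field K] [NumberField K] (hK : IsImaginaryQuadratic K) {D : ℤ}
    (hD : NumberField.discr K = D) (h3 : D ≠ -3) (h4 : D ≠ -4)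
    (hH : ∀ q : ℕ, q.Prime → (q : ℤ) ∣ E₀.Δ → (q = 2 → D % 8 = 1) ∧ (q ≠ 2 → jacobiSym D q = 1))
    (ℓ₁ : ℕ) (hℓ₁ : ℓ₁.Prime) (hℓ₁2 : ℓ₁ ≠ 2) (hℓ₁Δ : ¬ (ℓ₁ : ℤ) ∣ E₀.Δ) (hℓ₁D : ¬ (ℓ₁ : ℤ) ∣ D)
    (hℓ₁p : ℓ₁ ≠ p) (hjac₁ : jacobiSym D ℓ₁ = -1) (hℓ₁1 : p ∣ ℓ₁ + 1) {n₁ : ℕ}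
    (hcard₁ : Nat.card ((E₀.map (Int.castRingHom (ZMod ℓ₁))).toAffine.Point) = n₁)
    (haℓ₁ : (p : ℤ) ∣ (ℓ₁ : ℤ) + 1 - n₁)
    (ℓ₂ : ℕ) (hℓ₂ : ℓ₂.Prime) (hℓ₂2 : ℓ₂ ≠ 2) (hℓ₂Δ : ¬ (ℓ₂ : ℤ) ∣ E₀.Δ) (hℓ₂D : ¬ (ℓ₂ : ℤ) ∣ D)
    (hℓ₂p : ℓ₂ ≠ p) (hjac₂ : jacobiSym D ℓ₂ = -1) (hℓ₂1 : p ∣ ℓ₂ + 1) {n₂ : ℕ}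
    (hcard₂ : Nat.card ((E₀.map (Int.castRingHom (ZMod ℓ₂))).toAffine.Point) = n₂)
    (haℓ₂ : (p : ℤ) ∣ (ℓ₂ : ℤ) + 1 - n₂) (hℓℓ : ℓ₁ ≠ ℓ₂)
    [NeZero (W.conductorNorm ℤ)] (Dt : ModularParametrizationData W (W.conductorNorm ℤ)) (β : ℤ)
    (ι : K →+* ℂ) (d : KolyvaginHeegnerData Dt β ι (ℓ₁ * ℓ₂))
    (hne : d.kolyvaginClass hp.out 1 ≠ 0) :
    W.shaCorank p = 0 ∧ W.mordellWeilRank = 3 ∧ (W.quadraticTwist (D : ℚ)).mordellWeilRank ≤ 2 ∧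
      (∀ P : W.toAffine.Point, p • P = 0 → P = 0) ∧ (∀ c ∈ W.sha, p • c = 0 → c = 0) ∧
      Nat.card ↥(selmerGroup W (p : ℤ)) = p ^ 3 ∧
      Nat.card ↥(selmerGroup (W.quadraticTwist (D : ℚ)) (p : ℤ)) ≤ p ^ 2 := by
  obtain ⟨h54, h43, h44, h53, h22⟩ := mcCallumLeaves_of_print h372 hE0
  exact depthRowTwo_noTwist_of_datum_of_intModel_certificate hI h54 h43 h44 h53 h22 hcm hr p hp2 htower
    K hK hD h3 h4 hH ℓ₁ hℓ₁ hℓ₁2 hℓ₁Δ hℓ₁D hℓ₁p hjac₁ hℓ₁1 hcard₁ haℓ₁ ℓ₂ hℓ₂ hℓ₂2 hℓ₂Δ hℓ₂D hℓ₂p hjac₂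
    hℓ₂1 hcard₂ haℓ₂ hℓℓ Dt β ι d hne

end Kits

/-! ## Planner-facing: the datum-form assembly on (γ) + F1 -/

/-- **KDS_datum + (γ) + F1 + the CM residual ⟹ X1 for every elliptic curve over `ℚ`** — g7's
`shaCorankZeroAtOnePrime_of_kolyvaginDepthSupplyDatum` with the five leaves fed by
`mcCallumLeaves_of_print`: the body of `KatoTransfer`'s crux `ShaCorankZeroAtOnePrime`
(stmt-BirchSwinnertonDyer-18411). CONDITIONAL on `hS`, (γ), F1, `hCM`; BSD is not proved by it.
[cite: Kolyvagin1991MathAnn, Thm. 2.3] [cite: GrossLMS1991, Prop. 3.7 (2)] [cite: GrossZagier1986, III (3.1)] -/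
theorem shaCorankZeroAtOnePrime_of_kolyvaginDepthSupplyDatum_print (hS : KolyvaginDepthSupplyDatum)
    (h372 : GrossLMS1991.prop37_2_frobeniusCongruence)
    (hE0 : Gross1991_heegnerPoint_sub_ratTorsion_mem_E0) (hCM : ShaCorankZeroAtOnePrimeOfCM) :
    ∀ (W : WeierstrassCurve ℚ) [W.IsElliptic] [W.IsGloballyMinimal],
      ∃ (p : ℕ) (_ : Fact p.Prime), 5 ≤ p ∧ W.HasGoodReductionAtPrime p ∧
        ¬ (p : ℤ) ∣ W.frobeniusTrace p ∧ W.shaCorank p = 0 := by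
  obtain ⟨h54, h43, h44, h53, h22⟩ := mcCallumLeaves_of_print h372 hE0
  exact shaCorankZeroAtOnePrime_of_kolyvaginDepthSupplyDatum hS h54 h43 h44 h53 h22 hCM

/-- **The route from the datum form on print-standard inputs: KDS_datum + (γ) + F1 + X1_CM + X2 + X3
+ Kato ⟹ BSD-rank** — g7's `bsd_of_kolyvaginDepthSupplyDatum` with the five McCallum leaves replaced
by the two Literature facts (γ) (Gross 1991 Prop. 3.7 (2)) and F1 ([GZ86 III (3.1)]); the XL support
item `KolyvaginStructure` is not used either. Every hypothesis is OPEN or a named published fact;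
NOTHING class-wide is discharged and BSD is NOT proved by this.
[cite: Kolyvagin1991MathAnn, Thm. 2.3] [cite: Kato2004Asterisque, Thm. 17.4] -/
theorem bsd_of_kolyvaginDepthSupplyDatum_print (hS : KolyvaginDepthSupplyDatum)
    (h372 : GrossLMS1991.prop37_2_frobeniusCongruence)
    (hE0 : Gross1991_heegnerPoint_sub_ratTorsion_mem_E0) (hCM : ShaCorankZeroAtOnePrimeOfCM)
    (hX2 : AnalyticRankLeSelmerCorank) (hX3 : PadicOrderLeAnalyticRankAtOnePrime)
    (hK : KatoRankBound) : _root_.BirchSwinnertonDyer := by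
  obtain ⟨h54, h43, h44, h53, h22⟩ := mcCallumLeaves_of_print h372 hE0
  exact bsd_of_kolyvaginDepthSupplyDatum hS h54 h43 h44 h53 h22 hCM hX2 hX3 hK

end Summit.BirchSwinnertonDyer.BirchSwinnertonDyer.Theorems.KolyvaginDepthDoor

end
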